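import Summits.BirchSwinnertonDyer.BirchSwinnertonDyer.Theorems.GenusKolyvaginAtTwoGenusPrimitiveSupplyAtTwoPrimeTwistRealPlace
import HarnessLib

/-!
# Route `GenusKolyvaginAtTwo`, crux #2 `GenusPrimitiveSupplyAtTwo` (stmt-BirchSwinnertonDyer-22136):
# THE PRIME-TWIST SELMER LAWS BY STRATUM — egg DOWN law `2·#Sel_𝔓(A_χ) = #Sel₂(W)`, `Δ < 0` NO-CHANGE law, off-egg dichotomy

Width seat `bsd-line-gk2-p5` g14 (cell `bsd-f1-sign2`, SUPPLY lineage of crux 22136), file 36 of the series; sequel of file 35 (`…PrimeTwistRealPlace`).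
THEOREMS ONLY (no definition, no named fact, no `sorry`); helper `--supports stmt-BirchSwinnertonDyer-22136`; no item is closed; BSD is not proved.

WHAT. For a globally minimal elliptic `W/ℚ`, a descent-admissible `d` and its quadratic character `χ`, the position of `Sel_𝔓(A_χ/ℚ)` inside
`H¹(ℚ, E[2])` by stratum (files 34–35: `Sel₂^{str ∞} ≤ Sel_𝔓 ≤ Sel₂^{rel ∞}`, `Sel_𝔓 ⊓ Sel₂ = Sel₂^{str ∞}`):
* §153 `Δ_pos_of_meetsEgg`, **`relIndex_kummerStrict_selmerGroup_eq_two_of_meetsEgg`** (`[Sel₂(W) : Sel₂^{str ∞}(W)] = 2` on the egg stratum) and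
  **`two_mul_natCard_primeTwist_selmerGroup_eq_selmerTwoCard_of_meetsEgg`** — THE EGG DOWN LAW in prime-twist currency: `2·#Sel_𝔓(A_χ/ℚ) = #Sel₂(W)`,
  `Sel_𝔓(A_χ) = ker(loc_∞ | Sel₂(W))` of index `2` (cf. the cell's -desc §27 row E `EggDoorDownLawAtTwo`: `2·#Sel₂(W^{(d)}) = #Sel₂(W)`).
* §154 off the egg for `Δ_W > 0` (with `E(ℚ)[2] = 0`, `Ш(W)[2] = 0`): `Sel₂(W) = Sel₂^{str ∞}(W) ≤ Sel_𝔓(A_χ) ≤ Sel₂^{rel ∞}(W)` with `[rel : Sel₂] = 2`, so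
  **`primeTwist_selmerGroup_eq_or_eq_of_not_meetsEgg`**: `Sel_𝔓(A_χ) = Sel₂(W)` or `= Sel₂^{rel ∞}(W)`, and `#Sel_𝔓(A_χ) ∈ {#Sel₂(W), 2·#Sel₂(W)}`
  (DESC-§17-R's equality clause picks the second exactly when `#Sel_𝔓 = 2·#Sel₂`; Kramer's parity says it always does — not proved here).
* (`Δ_W < 0`: `Sel_𝔓(A_χ) = Sel₂(W)`, file 34.)

Honest framing: KNOWN in print (Kramer 1981 Thm. 1 with Prop. 6–7; MR 2010 Prop. 3.3); kernel-new; beyond-print theorem: no. Crux 22136 stays OPEN exactly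
at (U) 24947 ∧ (CONV₂) 19220/24948. BSD is not proved by any of this.

References: [Kramer1981] Thm. 1, Prop. 6, Prop. 7; [MazurRubin2010] Lemma 3.2, Prop. 3.3; [MazurRubin2007] Prop. 5.2.
-/

set_option linter.dupNamespace false -- tree convention: `Summit.BirchSwinnertonDyer.BirchSwinnertonDyer.Theorems` (summit = sub-problem)
set_option autoImplicit false

noncomputable section

open scoped Classical

namespace Summit.BirchSwinnertonDyer.BirchSwinnertonDyer.Theorems.GenusKolyArch

open WeierstrassCurve Field NumberField IsDedekindDomain Function
open Literature.NumberTheory.EllipticCurves Literature.NumberTheory.GaloisRepresentations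
open Literature.NumberTheory.GaloisCohomology
open Summit.BirchSwinnertonDyer.Rank1Residual.X11b.KummerPT (kummerStrict kummerRelaxed)
open Summit.BirchSwinnertonDyer.Rank1Residual.F1Sign2

variable (W : WeierstrassCurve ℚ) [W.IsElliptic] [W.IsGloballyMinimal] {d : ℤ} {χ : absoluteGaloisGroup ℚ →ₜ* Multiplicative (ZMod 2)}

/-! ## §153 The egg stratum: `[Sel₂(W) : Sel₂^{str ∞}(W)] = 2` and the DOWN law -/

omit [W.IsGloballyMinimal] in
/-- **A rational point on the egg forces `Δ_W > 0`** (its Kummer class is a Selmer class with `loc_∞ ≠ 0`, impossible for `Δ < 0` where `#𝓛_∞ = 1`).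
[cite: Kramer1981, §2 Prop. 6 (p. 127)] -/
theorem Δ_pos_of_meetsEgg (hegg : MeetsEgg W) : 0 < W.Δ := by
  rcases lt_trichotomy W.Δ 0 with hΔ | hΔ | hΔ
  · exfalso
    obtain ⟨c, hc, hne⟩ := exists_mem_selmerGroup_localization_inl_ne_zero_of_meetsEgg W hegg
    have hc' : c ∈ W.selmerGroup ((2 : ℕ) : ℤ) :=
      (SetLike.ext_iff.mp (W.selmerGroup_eq_selmerGroup_kummerSelmerStructure _) c).mpr hc
    exact hne (localization_inl_eq_zero_of_mem_selmerGroupRelaxedAtInfinityAtTwo_of_Δ_neg W hΔ Rat.infinitePlace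
      (selmerGroup_le_selmerGroupRelaxedAtInfinityAtTwo W hc'))
  · exact absurd hΔ W.isUnit_Δ.ne_zero
  · exact hΔ

omit [W.IsGloballyMinimal] in
/-- **On the egg stratum `[Sel₂(W) : Sel₂^{str ∞}(W)] = 2`**: `Sel₂^{rel ∞} = Sel₂` there (file 17) and `#loc_∞(Sel₂^{rel ∞}) = #𝓛_∞ = 2` for
`Δ > 0` (file 17), while `Sel₂^{str ∞} = ker(loc_∞) ⊓ Sel₂^{rel ∞}`. [cite: MazurRubin2010, Lemma 3.2] [cite: Kramer1981, Prop. 6] -/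
theorem relIndex_kummerStrict_selmerGroup_eq_two_of_meetsEgg (hegg : MeetsEgg W) (w : InfinitePlace ℚ) :
    (kummerStrict W 2 {(Sum.inl w : Place ℚ)}).selmerGroup.relIndex (W.selmerGroup ((2 : ℕ) : ℤ)) = 2 := by
  have hR := selmerGroupRelaxedAtInfinityAtTwo_eq_selmerGroup_of_meetsEgg W hegg
  rw [selmerGroup_kummerStrict_singleton_inl_eq_ker_inf W w, hR, AddSubgroup.inf_relIndex_right, AddSubgroup.relIndex_ker, ← hR]
  exact natCard_map_localization_inl_selmerGroupRelaxedAtInfinityAtTwo_eq_two_of_Δ_pos W (Δ_pos_of_meetsEgg W hegg) w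

omit [W.IsGloballyMinimal] in
/-- `2 · #Sel₂^{str ∞}(W) = #Sel₂(W)` on the egg stratum. [cite: MazurRubin2010, Lemma 3.2] [cite: Kramer1981, Prop. 6] -/
theorem two_mul_natCard_selmerGroup_kummerStrict_eq_selmerTwoCard_of_meetsEgg (hegg : MeetsEgg W) (w : InfinitePlace ℚ) :
    2 * Nat.card ((kummerStrict W 2 {(Sum.inl w : Place ℚ)}).selmerGroup) = selmerTwoCard W := by
  have h := natCard_mul_relIndex_eq_natCard (selmerGroup_kummerStrict_singleton_inl_le_selmerGroup W w)
  rw [relIndex_kummerStrict_selmerGroup_eq_two_of_meetsEgg W hegg w] at h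
  rw [mul_comm]
  exact h

/-- **THE EGG DOWN LAW in prime-twist currency: `2 · #Sel_𝔓(A_χ/ℚ) = #Sel₂(W)`** for `W` meeting the egg and every descent-admissible `d` with
character `χ` (`Sel_𝔓(A_χ) = Sel₂^{str ∞}(W)` by file 35, of index `2` in `Sel₂(W)`). Compare the cell's row E `EggDoorDownLawAtTwo`
(`2·#Sel₂(W^{(d)}) = #Sel₂(W)`, model currency). [cite: Kramer1981, Thm. 1 with Prop. 6–7] [cite: MazurRubin2010, Prop. 3.3] -/
theorem two_mul_natCard_primeTwist_selmerGroup_eq_selmerTwoCard_of_meetsEgg (hegg : MeetsEgg W) (hd : DescAdmissible W d)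
    (hχ : IsQuadraticCharacterOf χ d) : 2 * Nat.card (PrimeTwist.selmerGroup W χ) = selmerTwoCard W := by
  rw [primeTwist_selmerGroup_eq_selmerGroup_kummerStrict_of_meetsEgg W hegg hd hχ Rat.infinitePlace]
  exact two_mul_natCard_selmerGroup_kummerStrict_eq_selmerTwoCard_of_meetsEgg W hegg Rat.infinitePlace

/-- **Index form: `[Sel₂(W) : Sel_𝔓(A_χ/ℚ)] = 2` on the egg stratum.** [cite: Kramer1981, Thm. 1] [cite: MazurRubin2010, Prop. 3.3] -/
theorem relIndex_primeTwist_selmerGroup_selmerGroup_eq_two_of_meetsEgg (hegg : MeetsEgg W) (hd : DescAdmissible W d)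
    (hχ : IsQuadraticCharacterOf χ d) : (PrimeTwist.selmerGroup W χ).relIndex (W.selmerGroup ((2 : ℕ) : ℤ)) = 2 := by
  rw [primeTwist_selmerGroup_eq_selmerGroup_kummerStrict_of_meetsEgg W hegg hd hχ Rat.infinitePlace]
  exact relIndex_kummerStrict_selmerGroup_eq_two_of_meetsEgg W hegg Rat.infinitePlace

/-! ## §154 Off the egg (`Δ_W > 0`): the dichotomy -/

omit [W.IsGloballyMinimal] in
/-- **Off the egg (`Δ_W > 0`, `E(ℚ)[2] = 0`, `Ш(W)[2] = 0`): `Sel₂(W) = Sel₂^{str ∞}(W)`** (every Selmer class is trivial at `∞`, file 17).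
[cite: MazurRubin2010, Lemma 3.2] [cite: Kramer1981, Prop. 6] -/
theorem selmerGroup_eq_kummerStrict_of_not_meetsEgg (hΔ : 0 < W.Δ) (hT : NoRationalTwoTorsion W) (hSha : ShaTwoTrivial W)
    (hegg : ¬ MeetsEgg W) (w : InfinitePlace ℚ) :
    W.selmerGroup ((2 : ℕ) : ℤ) = (kummerStrict W 2 {(Sum.inl w : Place ℚ)}).selmerGroup :=
  selmerGroup_eq_selmerGroup_kummerStrict_of_forall_localization_eq_zero W w
    ((relIndex_selmerGroup_selmerGroupRelaxedAtInfinityAtTwo_eq_two_iff_of_Δ_pos W hΔ w).mp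
      (relIndex_selmerGroup_selmerGroupRelaxedAtInfinityAtTwo_eq_two_of_not_meetsEgg W hΔ hT hSha hegg))

/-- **Off the egg: `Sel₂(W) ≤ Sel_𝔓(A_χ/ℚ) ≤ Sel₂^{rel ∞}(W)`** for every descent-admissible `d` (the strict end IS `Sel₂(W)` there).
[cite: MazurRubin2010, Lemma 3.2 and Prop. 3.3] -/
theorem selmerGroup_le_primeTwist_selmerGroup_of_not_meetsEgg (hΔ : 0 < W.Δ) (hT : NoRationalTwoTorsion W) (hSha : ShaTwoTrivial W)
    (hegg : ¬ MeetsEgg W) (hd : DescAdmissible W d) (hχ : IsQuadraticCharacterOf χ d) :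
    W.selmerGroup ((2 : ℕ) : ℤ) ≤ PrimeTwist.selmerGroup W χ ∧ PrimeTwist.selmerGroup W χ ≤ selmerGroupRelaxedAtInfinityAtTwo W := by
  refine ⟨?_, primeTwist_selmerGroup_le_selmerGroupRelaxedAtInfinityAtTwo W hd hχ⟩
  rw [selmerGroup_eq_kummerStrict_of_not_meetsEgg W hΔ hT hSha hegg Rat.infinitePlace]
  exact selmerGroup_kummerStrict_le_primeTwist_selmerGroup W hd hχ Rat.infinitePlace

/-- **THE OFF-EGG DICHOTOMY: `Sel_𝔓(A_χ/ℚ) = Sel₂(W)` or `Sel_𝔓(A_χ/ℚ) = Sel₂^{rel ∞}(W)`** (`Δ_W > 0`, `E(ℚ)[2] = 0`, `Ш(W)[2] = 0`, `W` misses the egg,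
`d` descent-admissible): `[Sel₂^{rel ∞} : Sel₂] = 2` leaves no room in between. (Kramer's parity / DESC-§17-R's count clause decide for the second.)
[cite: MazurRubin2010, Lemma 3.2 and Prop. 3.3] [cite: Kramer1981, Thm. 1] -/
theorem primeTwist_selmerGroup_eq_or_eq_of_not_meetsEgg (hΔ : 0 < W.Δ) (hT : NoRationalTwoTorsion W) (hSha : ShaTwoTrivial W)
    (hegg : ¬ MeetsEgg W) (hd : DescAdmissible W d) (hχ : IsQuadraticCharacterOf χ d) :
    PrimeTwist.selmerGroup W χ = W.selmerGroup ((2 : ℕ) : ℤ) ∨ PrimeTwist.selmerGroup W χ = selmerGroupRelaxedAtInfinityAtTwo W := by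
  obtain ⟨h1, h2⟩ := selmerGroup_le_primeTwist_selmerGroup_of_not_meetsEgg W hΔ hT hSha hegg hd hχ
  have hmul := AddSubgroup.relIndex_mul_relIndex _ _ _ h1 h2
  rw [relIndex_selmerGroup_selmerGroupRelaxedAtInfinityAtTwo_eq_two_of_not_meetsEgg W hΔ hT hSha hegg] at hmul
  -- a factorisation `a * b = 2` in `ℕ` has `a = 1` or `b = 1`
  have hdvd : (W.selmerGroup ((2 : ℕ) : ℤ)).relIndex (PrimeTwist.selmerGroup W χ) ∣ 2 := ⟨_, hmul.symm⟩
  rcases (Nat.dvd_prime Nat.prime_two).mp hdvd with ha | ha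
  · left
    exact le_antisymm (AddSubgroup.relIndex_eq_one.mp ha) h1
  · right
    rw [ha] at hmul
    have hb : (PrimeTwist.selmerGroup W χ).relIndex (selmerGroupRelaxedAtInfinityAtTwo W) = 1 := by omega
    exact le_antisymm h2 (AddSubgroup.relIndex_eq_one.mp hb)

/-- **Cardinal form of the dichotomy: `#Sel_𝔓(A_χ/ℚ) = #Sel₂(W)` or `= 2·#Sel₂(W)`** off the egg. [cite: Kramer1981, Thm. 1] [cite: MazurRubin2010, Prop. 3.3] -/
theorem natCard_primeTwist_selmerGroup_eq_or_eq_of_not_meetsEgg (hΔ : 0 < W.Δ) (hT : NoRationalTwoTorsion W) (hSha : ShaTwoTrivial W)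
    (hegg : ¬ MeetsEgg W) (hd : DescAdmissible W d) (hχ : IsQuadraticCharacterOf χ d) :
    Nat.card (PrimeTwist.selmerGroup W χ) = selmerTwoCard W ∨ Nat.card (PrimeTwist.selmerGroup W χ) = 2 * selmerTwoCard W := by
  rcases primeTwist_selmerGroup_eq_or_eq_of_not_meetsEgg W hΔ hT hSha hegg hd hχ with h | h
  · left; rw [h]; rfl
  · right
    rw [h, natCard_selmerGroupRelaxedAtInfinityAtTwo_eq_mul W,
      relIndex_selmerGroup_selmerGroupRelaxedAtInfinityAtTwo_eq_two_of_not_meetsEgg W hΔ hT hSha hegg, mul_comm]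

/-- **Summary in the rank-one window (`Δ_W > 0`, `E(ℚ)[2] = 0`, `rank E(ℚ) = 1`, `Ш(W)[2] = 0`; `#Sel₂(W) = 2`)**: for every descent-admissible `d`,
`#Sel_𝔓(A_χ/ℚ) = 1` if `W` meets the egg, and `#Sel_𝔓(A_χ/ℚ) ∈ {2, 4}` if not. [cite: Kramer1981, Thm. 1] [cite: MazurRubin2010, Prop. 3.3] -/
theorem natCard_primeTwist_selmerGroup_rank_one (hΔ : 0 < W.Δ) (hT : NoRationalTwoTorsion W) (hrank : W.mordellWeilRank = 1)
    (hSha : ShaTwoTrivial W) (hd : DescAdmissible W d) (hχ : IsQuadraticCharacterOf χ d) :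
    (MeetsEgg W → Nat.card (PrimeTwist.selmerGroup W χ) = 1) ∧
      (¬ MeetsEgg W → Nat.card (PrimeTwist.selmerGroup W χ) = 2 ∨ Nat.card (PrimeTwist.selmerGroup W χ) = 4) := by
  have h2 := selmerTwoCard_eq_two_of_rank_one W hT hrank hSha
  refine ⟨fun hegg ↦ ?_, fun hegg ↦ ?_⟩
  · have h := two_mul_natCard_primeTwist_selmerGroup_eq_selmerTwoCard_of_meetsEgg W hegg hd hχ
    rw [h2] at h
    omega
  · rcases natCard_primeTwist_selmerGroup_eq_or_eq_of_not_meetsEgg W hΔ hT hSha hegg hd hχ with h | h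
    · left; rw [h, h2]
    · right; rw [h, h2]

end Summit.BirchSwinnertonDyer.BirchSwinnertonDyer.Theorems.GenusKolyArch

end
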